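import Literature.Geometry.ComplexAnalytic.PhamBrieskornA3InvolutionCohomology
import Literature.Geometry.ComplexAnalytic.PhamBrieskornFibreEigenvector
import Literature.AlgebraicTopology.SingularHomology.CoefficientCoordinateClasses
import HarnessLib

/-!
# Milnor's eigenvalue census for the `A₃` fibre over `ℚ`: `dim_ℚ ker(σ_*² + 1) = 2` and `dim_ℚ ker(σ_* + 1) = 1` on `H₂` and `H²` of
# the Milnor fibre of `z₀² + z₁² + z₂⁴` (Milnor 1968 §9 Thm. 9.1: the eigenvalues of the covering rotation are `i, −1, −i`, once each)

Family `hodge`, layer `Literature/Geometry/ComplexAnalytic`; sequel of `PhamBrieskornA3Involution` ∕ `PhamBrieskornA3InvolutionCohomology`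
(which prove `dim_ℚ ker(τ² + 1)` even and `≤ 2`, `dim_ℚ ker(τ + 1) ≥ 1`, over `ℚ` in homology and cohomology). Written by the prover
seat `hodge-nonav-prover-Ax` (g18), closing brick L6-3 of the LOC6 plan for crux K1Q `VeryGeneralQuaternionCommutatorsInHg` (route
`Summits/HodgeConjecture/HodgeConjecture/Theses/Q8SymplecticPowers.lean`, stub S5): the rank `2` of the `ι`-invariant vanishing part
`ker(τ² + 1)` is the rank of the planes `V₁, V₂` of the bireflection recognition. The missing inequality is that `τ ≠ −1` on
`H₂(F; ℚ)`, i.e. that the rotation `σ_{−1} : z₂ ↦ −z₂` is NOT the identity on RATIONAL homology. Over `ℂ` this is Milnor's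
eigenvector (`map_rotateFibre_ne_id`, tree); the passage to `ℚ` is the tree's `map_eq_id_of_algebra` (an identity of induced maps on
`Hₙ(−; ℚ)` ascends to `Hₙ(−; ℂ)`, Hatcher §3.A). This file PROVES:

* `exists_map_rotateFibre_neg_one_ne_rat` — some class of `H₂(F; ℚ)` is moved by `σ_{−1}`;
* **`finrank_ker_tauFour_add_one_eq_one`**, **`finrank_ker_tauFour_sq_add_one_eq_two`** (homology, `ℚ`);
* **`finrank_ker_cohomologyTauFour_add_one_eq_one`**, **`finrank_ker_cohomologyTauFour_sq_add_one_eq_two`** (cohomology, `ℚ`; the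
  identity `σ_{−1}^* = 1` on `H²` would force `σ_{−1*} = 1` on `H₂` by the perfect Kronecker pairing).

No HC content; no named fact; rung F-H1 not moved.

## References

* [Milnor1968] J. Milnor, Singular Points of Complex Hypersurfaces, Ann. of Math. Studies 61 (1968), §9, Thm. 9.1 and p. 77.
* [HatcherAT2002] A. Hatcher, Algebraic Topology, CUP 2002, §3.A Cor. 3A.4; §3.1 Thm. 3.2 (p. 195), p. 198.
-/

noncomputable section

open Complex ContinuousMap Set CategoryTheory
open Literature.AlgebraicTopology.SingularHomology

namespace Literature.Geometry.ComplexAnalytic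

namespace PhamBrieskorn

variable {ζ : ℂ} (hζ : IsPrimitiveRoot ζ 4)

/-- **The rotation `σ_{−1} : z₂ ↦ −z₂` moves some class of `H₂(F; ℚ)`** for the Milnor fibre of `z₀² + z₁² + z₂⁴` (Milnor's
eigenvector over `ℂ`, descended to `ℚ` by `map_eq_id_of_algebra`). [cite: Milnor1968, §9 Thm. 9.1 and p. 77] [cite: HatcherAT2002, §3.A Cor. 3A.4] -/
theorem exists_map_rotateFibre_neg_one_ne_rat :
    ∃ x : singularHomology ℚ ℚ (fibre (cyclicNodeExponents 4)) 2,
      singularHomology.map ℚ ℚ (rotateFibre (cyclicNodeExponents 4) (cyclicNodeExponents_ne_zero 4 four_ne_zero)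
        ⟨-1, neg_one_mem_Omega_cyclicNode_last 4 (by decide)⟩ : C(fibre (cyclicNodeExponents 4), fibre (cyclicNodeExponents 4))) 2 x ≠ x := by
  by_contra! h
  have hC := map_eq_id_of_algebra ℚ (L := ℂ) _ 2 h
  have hne := map_rotateFibre_ne_id (a := cyclicNodeExponents 4) (cyclicNodeExponents_ne_zero 4 four_ne_zero)
    (two_le_cyclicNodeExponents 4 (by norm_num)) ⟨-1, neg_one_mem_Omega_cyclicNode_last 4 (by decide)⟩ (by norm_num)
  exact hne (LinearMap.ext fun y => hC y)

/-- **`dim_ℚ ker(τ + 1) = 1` on `H₂(F; ℚ)`** (`τ = σ_{ζ*}`, `ζ` a primitive 4th root of unity): it is `1` or `3` (complement of the even-dimensional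
`ker(τ² + 1)` in dimension `3`), and `3` would make `τ² = σ_{−1*}` the identity on rational homology. Milnor: the eigenvalue `−1` occurs once.
[cite: Milnor1968, §9 Thm. 9.1 and p. 77] -/
theorem finrank_ker_tauFour_add_one_eq_one : Module.finrank ℚ (LinearMap.ker (tauFour ℚ hζ + 1)) = 1 := by
  haveI := finite_rat_singularHomology_fibre_cyclicNode_four
  have hsum := Submodule.finrank_add_eq_of_isCompl (isCompl_ker_add_one_ker_sq_add_one ℚ hζ)
  rw [finrank_rat_singularHomology_fibre_cyclicNode 4 four_ne_zero] at hsum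
  obtain ⟨k, hk⟩ := even_finrank_ker_sq_add_one hζ
  have h3 : Module.finrank ℚ (LinearMap.ker (tauFour ℚ hζ + 1)) ≠ 3 := by
    intro h3
    have htop : LinearMap.ker (tauFour ℚ hζ + 1) = ⊤ :=
      Submodule.eq_top_of_finrank_eq (by rw [h3, finrank_rat_singularHomology_fibre_cyclicNode 4 four_ne_zero])
    obtain ⟨x, hx⟩ := exists_map_rotateFibre_neg_one_ne_rat
    apply hx
    have hxk : x ∈ LinearMap.ker (tauFour ℚ hζ + 1) := by rw [htop]; exact Submodule.mem_top
    rw [LinearMap.mem_ker, LinearMap.add_apply, Module.End.one_apply] at hxk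
    have hτx : tauFour ℚ hζ x = -x := eq_neg_of_add_eq_zero_left hxk
    have h2 : (tauFour ℚ hζ ^ 2) x = x := by rw [pow_two, Module.End.mul_apply, hτx, map_neg, hτx, neg_neg]
    rw [tauFour_sq] at h2
    exact h2
  omega

/-- **`dim_ℚ ker(τ² + 1) = 2` on `H₂(F; ℚ)`**: the `ι`-invariant vanishing homology of the `A₃` point has rank `2` (Milnor: the eigenvalues
`±i` occur once each). [cite: Milnor1968, §9 Thm. 9.1 and p. 77] [cite: CarlsonToledo1999, §6 (held text p0013–p0014)] -/
theorem finrank_ker_tauFour_sq_add_one_eq_two : Module.finrank ℚ (LinearMap.ker (tauFour ℚ hζ ^ 2 + 1)) = 2 := by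
  haveI := finite_rat_singularHomology_fibre_cyclicNode_four
  have hsum := Submodule.finrank_add_eq_of_isCompl (isCompl_ker_add_one_ker_sq_add_one ℚ hζ)
  rw [finrank_rat_singularHomology_fibre_cyclicNode 4 four_ne_zero, finrank_ker_tauFour_add_one_eq_one hζ] at hsum
  omega

/-- **The rotation `σ_{−1}` moves some class of `H²(F; ℚ)`** (else, by the perfect Kronecker pairing over `ℚ`, it would fix `H₂(F; ℚ)`).
[cite: Milnor1968, §9 Thm. 9.1 and p. 77] [cite: HatcherAT2002, §3.1 Thm. 3.2 (p. 195) and p. 198] -/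
theorem exists_cohomologyMap_rotateFibre_neg_one_ne_rat :
    ∃ a : singularCohomology ℚ ℚ (fibre (cyclicNodeExponents 4)) 2,
      singularCohomology.map ℚ ℚ (rotateFibre (cyclicNodeExponents 4) (cyclicNodeExponents_ne_zero 4 four_ne_zero)
        ⟨-1, neg_one_mem_Omega_cyclicNode_last 4 (by decide)⟩ : C(fibre (cyclicNodeExponents 4), fibre (cyclicNodeExponents 4))) 2 a ≠ a := by
  by_contra! h
  obtain ⟨x, hx⟩ := exists_map_rotateFibre_neg_one_ne_rat
  apply hx
  -- every functional kills `σ_* x − x`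
  set f := (rotateFibre (cyclicNodeExponents 4) (cyclicNodeExponents_ne_zero 4 four_ne_zero)
    ⟨-1, neg_one_mem_Omega_cyclicNode_last 4 (by decide)⟩ : C(fibre (cyclicNodeExponents 4), fibre (cyclicNodeExponents 4))) with hf
  rw [← sub_eq_zero]
  refine (Module.forall_dual_apply_eq_zero_iff ℚ _).1 fun φ => ?_
  obtain ⟨a, rfl⟩ := (kroneckerPairing_bijective_of_field ℚ (fibre (cyclicNodeExponents 4)) 2).2 φ
  rw [map_sub, ← kroneckerPairing_map, h a, sub_self]

/-- **`dim_ℚ ker(τ^* + 1) = 1` on `H²(F; ℚ)`**. [cite: Milnor1968, §9 Thm. 9.1 and p. 77] -/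
theorem finrank_ker_cohomologyTauFour_add_one_eq_one : Module.finrank ℚ (LinearMap.ker (cohomologyTauFour ℚ hζ + 1)) = 1 := by
  haveI := finite_rat_singularCohomology_fibre_cyclicNode_four
  have hsum := Submodule.finrank_add_eq_of_isCompl (isCompl_ker_cohomologyTauFour ℚ hζ)
  rw [finrank_rat_singularCohomology_fibre_cyclicNode 4 (by norm_num)] at hsum
  obtain ⟨k, hk⟩ := even_finrank_ker_cohomologyTauFour_sq_add_one hζ
  have h3 : Module.finrank ℚ (LinearMap.ker (cohomologyTauFour ℚ hζ + 1)) ≠ 3 := by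
    intro h3
    have htop : LinearMap.ker (cohomologyTauFour ℚ hζ + 1) = ⊤ :=
      Submodule.eq_top_of_finrank_eq (by rw [h3, finrank_rat_singularCohomology_fibre_cyclicNode 4 (by norm_num)])
    obtain ⟨a, ha⟩ := exists_cohomologyMap_rotateFibre_neg_one_ne_rat
    apply ha
    have hak : a ∈ LinearMap.ker (cohomologyTauFour ℚ hζ + 1) := by rw [htop]; exact Submodule.mem_top
    rw [LinearMap.mem_ker, LinearMap.add_apply, Module.End.one_apply] at hak
    have hτa : cohomologyTauFour ℚ hζ a = -a := eq_neg_of_add_eq_zero_left hak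
    have h2 : (cohomologyTauFour ℚ hζ ^ 2) a = a := by rw [pow_two, Module.End.mul_apply, hτa, map_neg, hτa, neg_neg]
    -- `(τ^*)² = σ_{−1}^*` (transfer of `tauFour_sq`)
    have hsq := cohomologyMap_pow_eq_smul_pow_of_homology ℚ
      (rotateFibre (cyclicNodeExponents 4) (cyclicNodeExponents_ne_zero 4 four_ne_zero)
        ⟨-1, neg_one_mem_Omega_cyclicNode_last 4 (by decide)⟩ : C(fibre (cyclicNodeExponents 4), fibre (cyclicNodeExponents 4)))
      (rotateFibre (cyclicNodeExponents 4) (cyclicNodeExponents_ne_zero 4 four_ne_zero) ⟨ζ, hζ.pow_eq_one⟩ :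
        C(fibre (cyclicNodeExponents 4), fibre (cyclicNodeExponents 4))) 2 2 1 1
      (fun z => by rw [one_smul, pow_one]; exact congrArg (fun g => g z) (tauFour_sq ℚ hζ)) a
    rw [one_smul, pow_one] at hsq
    rw [hsq] at h2
    exact h2
  omega

/-- **`dim_ℚ ker((τ^*)² + 1) = 2` on `H²(F; ℚ)`**: the `ι`-invariant vanishing COHOMOLOGY of the `A₃` point has rank `2` — the rank of the
planes `V₁, V₂` of the bireflection recognition (`Q8BireflectionRecognition*`). [cite: Milnor1968, §9 Thm. 9.1 and p. 77]
[cite: CarlsonToledo1999, §6 (held text p0013–p0014)] -/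
theorem finrank_ker_cohomologyTauFour_sq_add_one_eq_two :
    Module.finrank ℚ (LinearMap.ker (cohomologyTauFour ℚ hζ ^ 2 + 1)) = 2 := by
  haveI := finite_rat_singularCohomology_fibre_cyclicNode_four
  have hsum := Submodule.finrank_add_eq_of_isCompl (isCompl_ker_cohomologyTauFour ℚ hζ)
  rw [finrank_rat_singularCohomology_fibre_cyclicNode 4 (by norm_num), finrank_ker_cohomologyTauFour_add_one_eq_one hζ] at hsum
  omega

end PhamBrieskorn

end Literature.Geometry.ComplexAnalytic

end
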